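import Summits.QuantumFields.YangMills.Theorems.LuscherReductionTwistedTraceScalingBTRatesCore
import HarnessLib

/-!
# The (B-T) SCHEDULE AT THE RATE WINDOW `δ = D·recordDelta1 L (1/6)`: lane A's elementary smallness conjuncts and first-order rates (`ε₁ + ε₂ ≤ 1`, `η ≤ 1`) re-run at the scaled
# `β^{-1/6}` window of the rate twin (route `FlatTubeReduction`, crux K1 `NearFlatRatioLaw` stmt-QuantumFields-24720; seat `ym-line-ftr-p1` g15; rate twin «ratepack-v3 / frozen fibres»;
# R2b1 RECORD rung — no summit statement is proved here)

WHY (memo `Cruxes/NearFlatRatioLaw/Lines/ratepack-v3-frozen-g12.md` §9; NOTES T6).  `…DressedFixedBeta.dressed_fixed_beta_estimate` has the hypotheses of lane A's `fixed_beta_estimate`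
(`…BTFixedBeta`) plus `η_s ≤ 1`, `coreEta ≤ 1`; lane A discharged them EVENTUALLY along its schedule (`btRad`, `btEps = β⁻¹`, `btAlpha = β^{-1/2}ℓ`, `btR1 = 5β^{-1/2}ℓ`, `T = 9L·btR1 + btEps`,
`Γ = btEps|Site|`, `P₀ = 13δ`) for the window `δ = recordDelta1 L s`, `0 < s < 1/2` (`…BTRatesAtoms`, `…BTRatesCore`).  The rate twin's window is `δ = D·recordDelta1 L (1/6)` (`D ≥ 1`); this file
re-runs the same real analysis at that window (proofs copied, `p = D·β^{-1/6}`):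
* `eventually_rate_schedule_facts`, `eventually_rate_schedule_facts₂` — the pointwise fact bundles; ★ `eventually_small_elementary_D` — the elementary conjuncts;
* ★ `eventually_coreEps_sum_le_one_D`, ★ `eventually_coreEta_le_one_D` — the first-order rates `≤ 1` (atoms `coreEps1_le_atom`, `coreEps2_le_atom`, `coreEta_le_atom` of lane A).
HONEST FRAMING: real-analysis bookkeeping for a stub of the CONDITIONAL reduction route R2b1; the rate `κ₀ = O(λ_b²)` and the tail budget are the sequel; femto rung R2b1 (RECORD label);
not infinite volume, not a gap, not Clay.  No defs, no named facts, no `sorry`.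
-/

set_option autoImplicit false

noncomputable section

open MeasureTheory Filter Topology Real
open scoped BigOperators
open Literature.MathematicalPhysics.QuantumFieldTheory
open Literature.MathematicalPhysics.QuantumLattice

namespace Summit.QuantumFields.YangMills.Theorems.FemtoTransferGap.TwoLattice.ConstTube

open Summit.QuantumFields.YangMills.Theorems.FemtoTransferGap
open Summit.QuantumFields.YangMills.Theorems.FemtoTransferGap.TwoLattice
open Summit.QuantumFields.YangMills.Theorems.FemtoTransferGap.TwoLattice.Avg
open Summit.QuantumFields.YangMills.Theorems.FemtoTransferGap.TwoLattice.Cov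

variable {L : ℕ} [NeZero L]

/-! ## §1 The fact bundles at the rate window -/

/-- Eventually (`D ≥ 1`, `δ = D·recordDelta1 L (1/6)`): `β ≥ 1`, `ℓ = log β ≥ 6`, `r = x := β^{-1/2}`, `ε ≤ x ≤ δ/28`, `xℓ < 1/(60L)`, `R₁ < 1/(600L)`, `δ < 1/(4000L)`, `ε < 1/600`,
`δ ≤ 1/2`. [folklore] -/
theorem eventually_rate_schedule_facts {D : ℝ} (hD : 1 ≤ D) :
    ∀ᶠ β : ℝ in atTop, 1 ≤ β ∧ btLog β = Real.log β ∧ 6 ≤ Real.log β ∧ btRad β = powScale (1 / 2) β ∧ btEps β ≤ powScale (1 / 2) β ∧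
      powScale (1 / 2) β ≤ D * recordDelta1 L (1 / 6) β / 28 ∧ powScale (1 / 2) β * Real.log β < 1 / (60 * L) ∧ btR1 β < 1 / (600 * L) ∧
      D * recordDelta1 L (1 / 6) β < 1 / (4000 * L) ∧ btEps β < 1 / 600 ∧ D * recordDelta1 L (1 / 6) β ≤ 1 / 2 := by
  have hL0 : (0 : ℝ) < L := by exact_mod_cast NeZero.pos L
  have hδt : Tendsto (fun β : ℝ => D * recordDelta1 L (1 / 6) β) atTop (𝓝 0) := by
    simpa using (tendsto_recordDelta1 (L := L) (show (0 : ℝ) < 1 / 6 by norm_num)).const_mul D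
  filter_upwards [eventually_schedule_facts (L := L) (show (0 : ℝ) < 1 / 6 by norm_num) (by norm_num),
    hδt.eventually (eventually_lt_nhds (show (0 : ℝ) < 1 / (4000 * L) by positivity)), hδt.eventually (eventually_le_nhds (show (0 : ℝ) < 1 / 2 by norm_num))]
    with β hf hδs hδhalf
  obtain ⟨hβ1, hℓeq, hℓ6, hreq, hεx, hxδ, hxℓ, hR₁, -, hεs, -⟩ := hf
  have hδ0 : 0 ≤ recordDelta1 L (1 / 6) β := by
    unfold recordDelta1; exact div_nonneg (mul_nonneg (by norm_num) (powScale_pos _ _).le) (Nat.cast_nonneg _)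
  have hxδ' : powScale (1 / 2) β ≤ D * recordDelta1 L (1 / 6) β / 28 := hxδ.trans (by rw [div_le_div_iff_of_pos_right (by norm_num)]; nlinarith)
  exact ⟨hβ1, hℓeq, hℓ6, hreq, hεx, hxδ', hxℓ, hR₁, hδs, hεs, hδhalf⟩

/-! ## §2 ★ The elementary smallness conjuncts at the rate window -/

set_option maxHeartbeats 400000 in
/-- ★ **The elementary conjuncts of the smallness hypotheses of `dressed_fixed_beta_estimate`**, eventually, at the window `δ = D·recordDelta1 L (1/6)` (`D ≥ 1`). [folklore] -/
theorem eventually_small_elementary_D {D : ℝ} (hD : 1 ≤ D) :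
    ∀ᶠ β : ℝ in atTop,
      0 ≤ β ∧ (D * recordDelta1 L (1 / 6) β) ≤ 1 / 2 ∧ btAlpha β ≤ 1 ∧ btRad β ≤ 9 * L * btR1 β + btEps β ∧ 9 * L * btR1 β + btEps β ≤ 1 / 30 ∧
      (L : ℝ) ^ 3 * (12 * (D * recordDelta1 L (1 / 6) β) ^ 4) < 2 ∧
      18 * L * (Real.sqrt 2 * btRad β + (D * recordDelta1 L (1 / 6) β)) ≤ 1 / 2 ∧
      0 ≤ btR1 β / 2 - 2 * (Real.sqrt 2 * btRad β + (D * recordDelta1 L (1 / 6) β)) * btEps β - (2 * Real.sqrt 2 * btRad β + btAlpha β) ∧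
      0 ≤ 1 / (3 * L) - 4 * (Real.sqrt 2 * btRad β + (D * recordDelta1 L (1 / 6) β)) - (2 * Real.sqrt 2 * btRad β + btAlpha β) ∧
      3 * L * (13 * (D * recordDelta1 L (1 / 6) β)) < 1 ∧
      0 ≤ 13 * (D * recordDelta1 L (1 / 6) β) - 4 * (Real.sqrt 2 * btRad β + (D * recordDelta1 L (1 / 6) β)) - (2 * Real.sqrt 2 * btRad β + 2 * (D * recordDelta1 L (1 / 6) β)) ∧
      2 * btEps β * Fintype.card (Site 3 L) * (D * recordDelta1 L (1 / 6) β) + 2 * btRad β ^ 2 +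
          2 * Real.sqrt 2 * Fintype.card (Site 3 L) * (9 * L * (13 * (D * recordDelta1 L (1 / 6) β)) + btEps β) * btRad β ≤
        Fintype.card (Site 3 L) * (1 - 3 * L * (13 * (D * recordDelta1 L (1 / 6) β))) * btAlpha β := by
  have hL1 : (1 : ℝ) ≤ L := by exact_mod_cast NeZero.one_le
  have hL0 : (0 : ℝ) < L := by linarith
  have hN1 : (1 : ℝ) ≤ Fintype.card (Site 3 L) := by exact_mod_cast Fintype.card_pos
  have hN : (0 : ℝ) < Fintype.card (Site 3 L) := by linarith
  have h2 : (0 : ℝ) < Real.sqrt 2 := Real.sqrt_pos.mpr (by norm_num)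
  have h22 : Real.sqrt 2 < 2 := by
    have := Real.sqrt_lt_sqrt (by norm_num : (0 : ℝ) ≤ 2) (show (2 : ℝ) < 4 by norm_num)
    rwa [show (4 : ℝ) = 2 ^ 2 by norm_num, Real.sqrt_sq (by norm_num : (0 : ℝ) ≤ 2)] at this
  filter_upwards [eventually_rate_schedule_facts (L := L) hD] with β hf
  obtain ⟨hβ1, hℓeq, hℓ6, hreq, hεx, hxδ, hxℓ, hR₁s, hδs, hεs, hδhalf⟩ := hf
  set x := powScale (1 / 2) β with hxdef
  set δ := D * recordDelta1 L (1 / 6) β with hδdef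
  have hx0 : 0 < x := powScale_pos _ _
  have hδ0 : 0 ≤ δ := by rw [hδdef]; unfold recordDelta1; exact mul_nonneg (by linarith) (div_nonneg (mul_nonneg (by norm_num) (powScale_pos _ _).le) hN.le)
  have hε0 : 0 < btEps β := powScale_pos _ _
  have hαeq : btAlpha β = x * Real.log β := by unfold btAlpha; rw [hℓeq]
  have hR₁eq : btR1 β = 5 * x * Real.log β := by unfold btR1; rw [hℓeq]
  have hLδ : (L : ℝ) * δ < 1 / 4000 := by
    have := mul_lt_mul_of_pos_left hδs hL0; rwa [show (L : ℝ) * (1 / (4000 * L)) = 1 / 4000 by field_simp] at this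
  have hδ4000 : δ < 1 / 4000 := lt_of_le_of_lt (le_mul_of_one_le_left hδ0 hL1) hLδ
  refine ⟨by linarith, hδhalf, ?_, ?_, ?_, ?_, ?_, ?_, ?_, ?_, ?_, ?_⟩
  · -- `α ≤ 1`
    rw [hαeq]; have : (1 : ℝ) / (60 * L) ≤ 1 := by rw [div_le_one (by positivity)]; linarith
    linarith
  · -- `r ≤ 9L R₁ + ε`
    rw [hreq, hR₁eq]
    have h1 : x ≤ x * Real.log β := le_mul_of_one_le_right hx0.le (by linarith)
    have h3 : x * Real.log β ≤ L * (x * Real.log β) := le_mul_of_one_le_left (by positivity) hL1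
    nlinarith
  · -- `9L R₁ + ε ≤ 1/30`
    have : 9 * (L : ℝ) * btR1 β < 9 * L * (1 / (600 * L)) := mul_lt_mul_of_pos_left hR₁s (by positivity)
    rw [show 9 * (L : ℝ) * (1 / (600 * L)) = 3 / 200 by field_simp; ring] at this
    linarith
  · -- `12 L³ δ⁴ < 2`
    have h3 : ((L : ℝ) * δ) ^ 3 ≤ (1 / 4000) ^ 3 := pow_le_pow_left₀ (by positivity) hLδ.le 3
    calc (L : ℝ) ^ 3 * (12 * δ ^ 4) = 12 * (((L : ℝ) * δ) ^ 3 * δ) := by ring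
      _ ≤ 12 * ((1 / 4000) ^ 3 * (1 / 2)) := by
          refine mul_le_mul_of_nonneg_left (mul_le_mul h3 hδhalf hδ0 (by positivity)) (by norm_num)
      _ < 2 := by norm_num
  · -- `18L(√2 r + δ) ≤ 1/2`: `√2 x ≤ 2x ≤ δ/14`
    rw [hreq]
    have hsx : Real.sqrt 2 * x ≤ 2 * x := mul_le_mul_of_nonneg_right h22.le hx0.le
    have h1 : Real.sqrt 2 * x ≤ δ / 14 := by linarith
    have h3 := mul_le_mul_of_nonneg_left h1 (by positivity : (0 : ℝ) ≤ 18 * L)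
    linarith
  · -- near-tail margin: `2.5xℓ − 2(√2x + δ)ε − 2√2x − xℓ ≥ 0`
    rw [hreq, hR₁eq, hαeq]
    have hsx : Real.sqrt 2 * x ≤ 2 * x := mul_le_mul_of_nonneg_right h22.le hx0.le
    have hδε : δ * btEps β ≤ 1 / 2 * x := mul_le_mul hδhalf hεx hε0.le (by norm_num)
    have hxε : x * btEps β ≤ x * (1 / 600) := mul_le_mul_of_nonneg_left hεs.le hx0.le
    have hsxε : Real.sqrt 2 * x * btEps β ≤ 2 * x * btEps β := mul_le_mul_of_nonneg_right hsx hε0.le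
    have hℓx : x * 6 ≤ x * Real.log β := mul_le_mul_of_nonneg_left hℓ6 hx0.le
    linarith
  · -- very-rough margin
    rw [hreq, hαeq]
    have hsx : Real.sqrt 2 * x ≤ 2 * x := mul_le_mul_of_nonneg_right h22.le hx0.le
    have hx1 : x ≤ x * Real.log β := le_mul_of_one_le_right hx0.le (by linarith)
    have hδ' : δ ≤ 1 / (60 * L) := by
      have : (1 : ℝ) / (4000 * L) ≤ 1 / (60 * L) := by rw [div_le_div_iff_of_pos_left one_pos (by positivity) (by positivity)]; nlinarith
      linarith
    have h13 : (1 : ℝ) / (3 * L) = 20 * (1 / (60 * L)) := by field_simp; ring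
    rw [h13]; linarith
  · -- `39 L δ < 1`
    linarith
  · -- rough margin `7δ − 6√2 x ≥ 0`
    rw [hreq]
    have hsx : Real.sqrt 2 * x ≤ 2 * x := mul_le_mul_of_nonneg_right h22.le hx0.le
    linarith
  · -- far junk below the far signal
    rw [hreq, hαeq]
    have h39 : 3 * (L : ℝ) * (13 * δ) ≤ 1 / 2 := by linarith
    have hRHS : Fintype.card (Site 3 L) * (1 / 2) * (x * Real.log β) ≤ Fintype.card (Site 3 L) * (1 - 3 * L * (13 * δ)) * (x * Real.log β) :=
      mul_le_mul_of_nonneg_right (mul_le_mul_of_nonneg_left (by linarith) hN.le) (by positivity)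
    have t1 : 2 * btEps β * Fintype.card (Site 3 L) * δ ≤ Fintype.card (Site 3 L) * x := by
      have h := mul_le_mul hεx hδhalf hδ0 hx0.le
      have := mul_le_mul_of_nonneg_left h (by positivity : (0 : ℝ) ≤ 2 * Fintype.card (Site 3 L))
      linarith
    have hxle : x ≤ 1 / 2 := by have := (btRad_pos_le β).2; rw [hreq] at this; linarith
    have t2 : 2 * x ^ 2 ≤ x := by nlinarith
    have t3 : 2 * Real.sqrt 2 * Fintype.card (Site 3 L) * (9 * L * (13 * δ) + btEps β) * x ≤ Fintype.card (Site 3 L) * x / 2 := by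
      have hin : 9 * (L : ℝ) * (13 * δ) + btEps β ≤ 117 / 4000 + 1 / 600 := by linarith
      have h1 := mul_le_mul_of_nonneg_left hin (by positivity : (0 : ℝ) ≤ 2 * Real.sqrt 2 * Fintype.card (Site 3 L) * x)
      have h2 := mul_le_mul_of_nonneg_right h22.le (by positivity : (0 : ℝ) ≤ Fintype.card (Site 3 L) * x)
      have hNx : 0 ≤ (Fintype.card (Site 3 L) : ℝ) * x := by positivity
      nlinarith [h1, h2, hNx]
    have hx' : x ≤ Fintype.card (Site 3 L) * x := le_mul_of_one_le_left hx0.le hN1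
    have hℓN : Fintype.card (Site 3 L) * x * 6 ≤ Fintype.card (Site 3 L) * x * Real.log β := mul_le_mul_of_nonneg_left hℓ6 (by positivity)
    linarith


/-! ## §3 The second fact bundle and the first-order rates at the rate window -/

/-- Eventually along the schedule at the rate window: the elementary hypotheses of lane A's envelopes (`p = D·β^{-1/6}`). [folklore] -/
theorem eventually_rate_schedule_facts₂ {D : ℝ} (hD : 1 ≤ D) :
    ∀ᶠ β : ℝ in atTop, 1 ≤ β ∧ btLog β = Real.log β ∧ 1 ≤ btLog β ∧ btRad β = powScale (1 / 2) β ∧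
      0 ≤ (D * recordDelta1 L (1 / 6) β) ∧ (D * recordDelta1 L (1 / 6) β) ≤ 14 * (D * powScale (1 / 6) β) ∧ (D * recordDelta1 L (1 / 6) β) ≤ 1 ∧
      0 ≤ powScale (1 / 2) β ∧ powScale (1 / 2) β ≤ 1 ∧ (D * powScale (1 / 6) β) ^ 2 = D ^ 2 * powScale (1 / 3) β ∧
      0 ≤ 9 * L * btR1 β + btEps β ∧ 9 * L * btR1 β + btEps β ≤ 1 ∧ 9 * L * btR1 β + btEps β ≤ 46 * L * powScale (1 / 2) β * btLog β ∧
      β * (9 * L * btR1 β + btEps β) ^ 2 ≤ 2116 * (L : ℝ) ^ 2 * btLog β ^ 2 ∧ β * btRad β ^ 2 = 1 ∧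
      0 ≤ (L : ℝ) ^ 3 * (12 * (D * recordDelta1 L (1 / 6) β) ^ 4) ∧ (L : ℝ) ^ 3 * (12 * (D * recordDelta1 L (1 / 6) β) ^ 4) ≤ 2 ∧
      (L : ℝ) ^ 3 * (12 * (D * recordDelta1 L (1 / 6) β) ^ 4) ≤ 12 * (L : ℝ) ^ 3 * (D * recordDelta1 L (1 / 6) β) ^ 2 ∧
      Real.sqrt ((L : ℝ) ^ 3 * (12 * (D * recordDelta1 L (1 / 6) β) ^ 4)) ≤ 4 * (L : ℝ) ^ 2 * (D * recordDelta1 L (1 / 6) β) ^ 2 ∧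
      β * (btEps β * Fintype.card (Site 3 L)) = (Fintype.card (Site 3 L) : ℝ) ∧ btAlpha β = powScale (1 / 2) β * btLog β ∧ btAlpha β ≤ 1 := by
  have hL1 : (1 : ℝ) ≤ L := by exact_mod_cast NeZero.one_le
  have hL0 : (0 : ℝ) < L := by linarith
  have hN1 : (1 : ℝ) ≤ Fintype.card (Site 3 L) := by exact_mod_cast Fintype.card_pos
  have hN : (0 : ℝ) < Fintype.card (Site 3 L) := by linarith
  filter_upwards [eventually_rate_schedule_facts (L := L) hD, eventually_small_elementary_D (L := L) hD] with β hf hel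
  obtain ⟨hβ1, hℓeq, hℓ6, hreq, hεx, -, -, -, hδs, -, hδhalf⟩ := hf
  obtain ⟨-, -, hα1, -, hT30, hσ2, -⟩ := hel
  set x := powScale (1 / 2) β with hxdef
  set δ := D * recordDelta1 L (1 / 6) β with hδdef
  set ℓ := btLog β with hℓdef
  have hx0 : 0 < x := powScale_pos _ _
  have hx1 : x ≤ 1 := powScale_le_one (by norm_num) β
  have hℓ1 : 1 ≤ ℓ := one_le_btLog β
  have hp0 : 0 < D * powScale (1 / 6) β := mul_pos (by linarith) (powScale_pos _ _)
  have hδ0 : 0 ≤ δ := by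
    rw [hδdef]; unfold recordDelta1; exact mul_nonneg (by linarith) (div_nonneg (mul_nonneg (by norm_num) (powScale_pos _ _).le) hN.le)
  have hδp : δ ≤ 14 * (D * powScale (1 / 6) β) := by
    rw [hδdef]; unfold recordDelta1
    rw [show D * (14 * powScale (1 / 6) β / Fintype.card (Site 3 L)) = 14 * (D * powScale (1 / 6) β) / Fintype.card (Site 3 L) by ring, div_le_iff₀ hN]
    nlinarith [hp0]
  have hδ1 : δ ≤ 1 := by linarith
  have hε0 : 0 < btEps β := powScale_pos _ _
  have hp2 : (D * powScale (1 / 6) β) ^ 2 = D ^ 2 * powScale (1 / 3) β := by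
    have hβ0 : 0 ≤ β := by linarith
    have h16 : powScale (1 / 6) β ^ 2 = powScale (1 / 3) β := by
      rw [powScale_eq hβ1, powScale_eq hβ1, ← Real.rpow_mul_natCast hβ0]; congr 1; push_cast; ring
    rw [mul_pow, h16]
  have hR₁eq : btR1 β = 5 * x * ℓ := rfl
  have hT0 : 0 ≤ 9 * L * btR1 β + btEps β := by rw [hR₁eq]; positivity
  have hTx : 9 * L * btR1 β + btEps β ≤ 46 * L * x * ℓ := by
    rw [hR₁eq]
    have h1 : btEps β ≤ x * ℓ := hεx.trans (le_mul_of_one_le_right hx0.le hℓ1)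
    have h2 : x * ℓ ≤ L * (x * ℓ) := le_mul_of_one_le_left (by positivity) hL1
    nlinarith
  have hβx : β * x ^ 2 = 1 := mul_powScale_half_sq hβ1
  have hT2 : β * (9 * L * btR1 β + btEps β) ^ 2 ≤ 2116 * (L : ℝ) ^ 2 * ℓ ^ 2 := by
    have h := pow_le_pow_left₀ hT0 hTx 2
    calc β * (9 * L * btR1 β + btEps β) ^ 2 ≤ β * (46 * L * x * ℓ) ^ 2 := mul_le_mul_of_nonneg_left h (by linarith)
      _ = 2116 * (L : ℝ) ^ 2 * ℓ ^ 2 * (β * x ^ 2) := by ring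
      _ = 2116 * (L : ℝ) ^ 2 * ℓ ^ 2 := by rw [hβx, mul_one]
  have hβR : β * btRad β ^ 2 = 1 := by rw [hreq]; exact hβx
  have hσ0 : 0 ≤ (L : ℝ) ^ 3 * (12 * δ ^ 4) := by positivity
  have hσδ : (L : ℝ) ^ 3 * (12 * δ ^ 4) ≤ 12 * (L : ℝ) ^ 3 * δ ^ 2 := by
    have h4 : δ ^ 4 ≤ δ ^ 2 := pow_le_pow_of_le_one hδ0 hδ1 (show 2 ≤ 4 by norm_num)
    calc (L : ℝ) ^ 3 * (12 * δ ^ 4) = 12 * (L : ℝ) ^ 3 * δ ^ 4 := by ring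
      _ ≤ 12 * (L : ℝ) ^ 3 * δ ^ 2 := by gcongr
  have hsσ : Real.sqrt ((L : ℝ) ^ 3 * (12 * δ ^ 4)) ≤ 4 * (L : ℝ) ^ 2 * δ ^ 2 := by
    rw [Real.sqrt_le_left (by positivity)]
    have hL34 : (L : ℝ) ^ 3 ≤ (L : ℝ) ^ 4 := pow_le_pow_right₀ hL1 (by norm_num)
    have hδ4 : 0 ≤ δ ^ 4 := by positivity
    calc (L : ℝ) ^ 3 * (12 * δ ^ 4) ≤ (L : ℝ) ^ 4 * (16 * δ ^ 4) := mul_le_mul hL34 (by nlinarith) (by positivity) (by positivity)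
      _ = (4 * (L : ℝ) ^ 2 * δ ^ 2) ^ 2 := by ring
  have hΓ : β * (btEps β * Fintype.card (Site 3 L)) = (Fintype.card (Site 3 L) : ℝ) := by
    rw [← mul_assoc, show btEps β = powScale 1 β from rfl, mul_powScale_one hβ1, one_mul]
  have hαeq : btAlpha β = x * ℓ := rfl
  exact ⟨hβ1, hℓeq, hℓ1, hreq, hδ0, hδp, hδ1, hx0.le, hx1, hp2, hT0, by linarith, hTx, hT2, hβR, hσ0, hσ2.le, hσδ, hsσ, hΓ, hαeq, hα1⟩

/-- ★ `ε₁ ≤ K·β^{-s}ℓ²` eventually. [folklore] -/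
theorem eventually_coreEps1_le_D {D : ℝ} (hD : 1 ≤ D) :
    ∃ K : ℝ, 0 ≤ K ∧ ∀ᶠ β : ℝ in atTop,
      coreEps1 L β ((D * recordDelta1 L (1 / 6) β)) (9 * L * btR1 β + btEps β) (btRad β) ≤ K * ((D * powScale (1 / 6) β) * btLog β ^ 2) := by
  refine ⟨14 * (288 * (Fintype.card (Edge 3 L) : ℝ) * (2116 * (L : ℝ) ^ 2) + 160 * (Fintype.card (Plaquette 3 L × Fin 3) : ℝ)), by positivity, ?_⟩
  filter_upwards [eventually_rate_schedule_facts₂ (L := L) hD] with β h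
  obtain ⟨hβ1, -, hℓ1, -, hδ0, hδp, -, -, -, -, -, -, -, hT2, hβR, -⟩ := h
  exact coreEps1_le_atom (by linarith) hδ0 hδp hℓ1 hT2 hβR.le

/-- ★ `ε₂ ≤ K·(β^{-2s} + β^{-1/2})ℓ⁴` eventually. [folklore] -/
theorem eventually_coreEps2_le_D {D : ℝ} (hD : 1 ≤ D) :
    ∃ K : ℝ, 0 ≤ K ∧ ∀ᶠ β : ℝ in atTop,
      coreEps2 L β ((D * recordDelta1 L (1 / 6) β)) (9 * L * btR1 β + btEps β) (btRad β) ((L : ℝ) ^ 3 * (12 * (D * recordDelta1 L (1 / 6) β) ^ 4)) ≤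
        K * ((D ^ 2 * powScale (1 / 3) β + powScale (1 / 2) β) * btLog β ^ 4) := by
  set A : ℝ := 2116 * (L : ℝ) ^ 2 with hA
  have hA0 : 0 ≤ A := by rw [hA]; positivity
  refine ⟨576 * 196 * (Fintype.card (Edge 3 L) : ℝ) * A + 50 * (12 * 196 * (L : ℝ) ^ 3) * (Fintype.card (Plaquette 3 L × Fin 3) : ℝ) +
      (Fintype.card (Plaquette 3 L) : ℝ) * (1728 * (4 * 196 * A * (L : ℝ) ^ 2) + 29376 * (46 * A * L) + 700569 * (2116 * A * (L : ℝ) ^ 2)) +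
      (Fintype.card (Plaquette 3 L) : ℝ) * (29376 * (46 * A * L) + 700569 * (2116 * A * (L : ℝ) ^ 2)) +
      145000000 * 196 * (Fintype.card (Plaquette 3 L × Fin 3) : ℝ), by positivity, ?_⟩
  filter_upwards [eventually_rate_schedule_facts₂ (L := L) hD] with β h
  obtain ⟨hβ1, -, hℓ1, -, hδ0, hδp, -, hx0, hx1, hp2, hT0, -, hTx, hT2, hβR, -, -, hσδ, hsσ, -⟩ := h
  have h := coreEps2_le_atom (L := L) (by linarith) hδ0 hδp hℓ1 hx0 hx1 hT0 hTx hT2 hA0 hβR.le hσδ hsσ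
  rw [hp2] at h
  exact h

/-- ★ `η ≤ K·(β^{-2s} + β^{-1/2})ℓ⁴` eventually. [folklore] -/
theorem eventually_coreEta_le_D {D : ℝ} (hD : 1 ≤ D) :
    ∃ K : ℝ, 0 ≤ K ∧ ∀ᶠ β : ℝ in atTop,
      coreEta L β ((D * recordDelta1 L (1 / 6) β)) (btAlpha β) (9 * L * btR1 β + btEps β) (btRad β) (btEps β * Fintype.card (Site 3 L))
          ((L : ℝ) ^ 3 * (12 * (D * recordDelta1 L (1 / 6) β) ^ 4)) ≤
        K * ((D ^ 2 * powScale (1 / 3) β + powScale (1 / 2) β) * btLog β ^ 4) := by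
  set A : ℝ := 2116 * (L : ℝ) ^ 2 with hA
  have hA0 : 0 ≤ A := by rw [hA]; positivity
  set N : ℝ := (Fintype.card (Site 3 L) : ℝ) with hNdef
  have hN0 : 0 ≤ N := Nat.cast_nonneg _
  refine ⟨(Fintype.card (Edge 3 L) : ℝ) * (558 * A + 192 * A) + 216 * N + 50 * (Fintype.card (Plaquette 3 L × Fin 3) : ℝ) * (12 * 196 * (L : ℝ) ^ 3) +
      (Fintype.card (Plaquette 3 L) : ℝ) * (1728 * (4 * 196 * A * (L : ℝ) ^ 2) + 29376 * (46 * A * L) + 700569 * (2116 * A * (L : ℝ) ^ 2)) +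
      5040 * (Fintype.card (Plaquette 3 L × Fin 3) : ℝ), by positivity, ?_⟩
  filter_upwards [eventually_rate_schedule_facts₂ (L := L) hD] with β h
  obtain ⟨hβ1, -, hℓ1, -, hδ0, hδp, hδ1, hx0, hx1, hp2, hT0, -, hTx, hT2, hβR, -, -, hσδ, hsσ, hΓ, hαeq, -⟩ := h
  have hβ0 : 0 ≤ β := by linarith
  have h := coreEta_le_atom (L := L) (N := N) hβ0 hδ0 hδp hδ1 hℓ1 hx0 hx1 hT0 hTx hT2 hA0 hβR.le hσδ hsσ (btAlpha_nonneg β) hαeq.le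
    (mul_nonneg (btEps_pos_le β).1.le (Nat.cast_nonneg _)) hΓ.le hN0
  rw [hp2] at h
  exact h


omit [NeZero L] in
/-- The atom `(D²β^{-1/3} + β^{-1/2})ℓ⁴ → 0`. [folklore] -/
theorem tendsto_btW_D (D : ℝ) : Tendsto (fun β : ℝ => (D ^ 2 * powScale (1 / 3) β + powScale (1 / 2) β) * btLog β ^ 4) atTop (𝓝 0) := by
  have h := ((tendsto_powScale_mul_btLog_pow (show (0 : ℝ) < 1 / 3 by norm_num) 4).const_mul (D ^ 2)).add
    (tendsto_powScale_mul_btLog_pow (show (0 : ℝ) < 1 / 2 by norm_num) 4)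
  rw [mul_zero, add_zero] at h
  exact h.congr' (Eventually.of_forall fun β => by ring)

/-- ★ **`ε₁ + ε₂ ≤ 1` eventually at the rate window.** [folklore] -/
theorem eventually_coreEps_sum_le_one_D {D : ℝ} (hD : 1 ≤ D) :
    ∀ᶠ β : ℝ in atTop,
      coreEps1 L β (D * recordDelta1 L (1 / 6) β) (9 * L * btR1 β + btEps β) (btRad β) +
          coreEps2 L β (D * recordDelta1 L (1 / 6) β) (9 * L * btR1 β + btEps β) (btRad β) ((L : ℝ) ^ 3 * (12 * (D * recordDelta1 L (1 / 6) β) ^ 4)) ≤ 1 := by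
  obtain ⟨K₁, hK₁, h₁⟩ := eventually_coreEps1_le_D (L := L) hD
  obtain ⟨K₂, hK₂, h₂⟩ := eventually_coreEps2_le_D (L := L) hD
  have t₁ : Tendsto (fun β : ℝ => K₁ * ((D * powScale (1 / 6) β) * btLog β ^ 2)) atTop (𝓝 0) := by
    have h := ((tendsto_powScale_mul_btLog_pow (show (0 : ℝ) < 1 / 6 by norm_num) 2).const_mul D).const_mul K₁
    rw [mul_zero, mul_zero] at h
    exact h.congr' (Eventually.of_forall fun β => by ring)
  have t₂ := (tendsto_btW_D D).const_mul K₂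
  rw [mul_zero] at t₂
  filter_upwards [h₁, h₂, t₁.eventually (eventually_le_nhds (show (0 : ℝ) < 1 / 2 by norm_num)), t₂.eventually (eventually_le_nhds (show (0 : ℝ) < 1 / 2 by norm_num))]
    with β a b c d
  linarith

/-- ★ **`η ≤ 1` (lane A's first-order near-pair rate) eventually at the rate window.** [folklore] -/
theorem eventually_coreEta_le_one_D {D : ℝ} (hD : 1 ≤ D) :
    ∀ᶠ β : ℝ in atTop,
      coreEta L β (D * recordDelta1 L (1 / 6) β) (btAlpha β) (9 * L * btR1 β + btEps β) (btRad β) (btEps β * Fintype.card (Site 3 L))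
        ((L : ℝ) ^ 3 * (12 * (D * recordDelta1 L (1 / 6) β) ^ 4)) ≤ 1 := by
  obtain ⟨K, hK, h⟩ := eventually_coreEta_le_D (L := L) hD
  have t := (tendsto_btW_D D).const_mul K
  rw [mul_zero] at t
  filter_upwards [h, t.eventually (eventually_le_nhds (show (0 : ℝ) < 1 by norm_num))] with β a b
  linarith

end Summit.QuantumFields.YangMills.Theorems.FemtoTransferGap.TwoLattice.ConstTube

end
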